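import Literature.AnabelianGeometry.SemiGraphs.MetabelianLeafStarElevLevels
import Literature.AnabelianGeometry.SemiGraphs.FreeProPRankTwoLevels
import Mathlib.Topology.Instances.ZMod
import HarnessLib

/-!
# The local characters of `𝒢⋆(p)`: translations `ψ_n` and the twisted abelian characters `Φ^{(n)}`
# («RAYLESS-STAR·CIV-NEG», brick S5d, part 1)

Mochizuki, *Semi-graphs of anabelioids*, Publ. RIMS **42** (2006), §3, Prop. 3.6 (ii) p. 38, Thm. 3.7 (i),
(iii) pp. 40–41 [cite: MochizukiSemiAnbd2006, Thm 3.7(iii) p.41].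

Construction file (abc-iut cell, layer L3, row «RAYLESS-STAR·CIV-NEG», seat abc-iut-L3-t8 gen 6; desk memo
VERTICAL-ESCAPE-RAYLESS-STAR-L3t8g6.md §4).  Two COMPATIBLE families of continuous local characters of the
rayless counter-carrier `𝒢⋆(p) = metabelianLeafStar p`, with values in `ℤ/p^e` (fed to abc-iut-L3-t8's
`exists_character_of_characters`, `TemperedTorsorCharacter.lean`):

* the TRANSLATION characters `ψ_{n,e}` (`leafStarPsiV n e`): at the leaf `n` the character
  `(a, u) ↦ a mod p^e` of `Leaf n = ℤ_p ⋊ ⟨1+p^{n+1}⟩‾` (`Iw.aChar`, a homomorphism for `e ≤ n + 1` because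
  `u ≡ 1 (mod p^{n+1})`), trivial at the centre, at the other leaves and on the edges; it kills every branch
  image and takes the value `1 (mod p^e)` on the unit translation;
* the TWISTED ABELIAN characters `Φ^{(n)}` (`leafStarPhiV n`, modulus `p^{n+1}`): at the centre
  `g ↦ v − p^n u` for `ab(g) = (u, v)` (`FreeProPRankTwo.linChar`), at the leaf `m` the character
  `(p^m − p^n) · log_{u_m}` (`Iw.logChar`), on the edge `m` the character `t ↦ (p^m − p^n) t`; `Φ^{(n)}(a) = −p^n ≠ 0`
  while `Φ^{(n)}` kills the branch image `⟨a·b^{pⁿ}⟩‾` of the edge `n` at the centre.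

No named fact; no side taken on [IUTchIII] Cor 3.12.
-/

noncomputable section

open Topology Multiplicative
open Literature.NumberTheory.GaloisRepresentations (OneUnits.continuous_toZModPow)

namespace Literature.AnabelianGeometry.SemiGraphs

open IwahoriWitness

variable {p : ℕ} [hp : Fact p.Prime]

/-! ### Reduction modulo `p^e` of `p`-adic integers of small norm -/

/-- A `p`-adic integer of norm `≤ p^{-e}` reduces to `0` modulo `p^e`. [cite: RibesZalesskii2010, §4.1] -/
theorem PadicIntLevels.toZModPow_eq_zero_of_norm_le {e : ℕ} {x : ℤ_[p]} (hx : ‖x‖ ≤ (p : ℝ) ^ (-(e : ℤ))) :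
    PadicInt.toZModPow e x = 0 := by
  rw [← RingHom.mem_ker, PadicInt.ker_toZModPow, ← PadicInt.norm_le_pow_iff_mem_span_pow]
  exact hx

/-! ### The translation characters of the leaves -/

namespace Iw

/-- For `x ∈ Leaf m` the unit coordinate satisfies `‖s‖ ≤ p^{-m}`, i.e. `u = 1 + p s ≡ 1 (mod p^{m+1})`.
[cite: MochizukiSemiAnbd2006, §2 p.23] -/
theorem norm_s_le_of_mem_leaf (m : ℕ) (x : Leaf (p := p) m) : ‖(x : Iw p).s‖ ≤ (p : ℝ) ^ (-(m : ℤ)) := by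
  have hu : (⟨(x : Iw p).s⟩ : IwU p) ∈ IwU.C m := (mem_leaf_iff m _).1 x.2
  rw [← IwU.range_zpowGen] at hu
  obtain ⟨t, ht⟩ := hu
  have h1 := IwU.toMod_zpowGen_eq_one (p := p) m 0 t.toAdd
  rw [pow_zero, one_mul, ofAdd_toAdd, Nat.add_zero] at h1
  have ht' : IwU.zpowGen m t = ⟨(x : Iw p).s⟩ := ht
  rw [ht', IwU.toMod_eq_one_iff] at h1
  exact h1

/-- For `x ∈ Leaf m` and `e ≤ m + 1`: `w(s) = 1 + p s ≡ 1 (mod p^e)`. [cite: MochizukiSemiAnbd2006, §2 p.23] -/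
theorem toZModPow_w_eq_one {e m : ℕ} (hem : e ≤ m + 1) (x : Leaf (p := p) m) :
    PadicInt.toZModPow e (w p (x : Iw p).s) = 1 := by
  rw [w, map_add, map_one, add_eq_left]
  apply PadicIntLevels.toZModPow_eq_zero_of_norm_le
  rw [norm_mul, PadicInt.norm_p]
  have hs := norm_s_le_of_mem_leaf m x
  have hp1 : (0 : ℝ) < (p : ℝ) := by exact_mod_cast hp.out.pos
  calc (p : ℝ)⁻¹ * ‖(x : Iw p).s‖ ≤ (p : ℝ)⁻¹ * (p : ℝ) ^ (-(m : ℤ)) :=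
        mul_le_mul_of_nonneg_left hs (inv_nonneg.2 hp1.le)
    _ = (p : ℝ) ^ (-((m + 1 : ℕ) : ℤ)) := by
        rw [← zpow_neg_one, ← zpow_add₀ hp1.ne']
        congr 1; push_cast; ring
    _ ≤ (p : ℝ) ^ (-(e : ℤ)) := by
        apply zpow_le_zpow_right₀ (by exact_mod_cast hp.out.one_lt.le)
        exact neg_le_neg (by exact_mod_cast hem)

/-- **The translation character** `ψ_{m,e} : Leaf m → ℤ/p^e`, `(a, u) ↦ a mod p^e`, for `e ≤ m + 1` (a
homomorphism because `u ≡ 1 (mod p^{m+1})`). [cite: MochizukiSemiAnbd2006, Thm 3.7(iii) p.41] -/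
def aChar (e m : ℕ) (hem : e ≤ m + 1) : Leaf (p := p) m →ₜ* Multiplicative (ZMod (p ^ e)) where
  toFun x := ofAdd (PadicInt.toZModPow e (x : Iw p).a)
  map_one' := by
    change ofAdd (PadicInt.toZModPow e (1 : Iw p).a) = 1
    rw [one_a, map_zero, ofAdd_zero]
  map_mul' x y := by
    change ofAdd (PadicInt.toZModPow e ((x : Iw p) * (y : Iw p)).a) = _
    rw [mul_a, map_add, map_mul, toZModPow_w_eq_one hem x, one_mul, ofAdd_add]
  continuous_toFun :=
    continuous_ofAdd.comp ((OneUnits.continuous_toZModPow p e).comp (continuous_a.comp continuous_subtype_val))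

/-- Formula. [cite: MochizukiSemiAnbd2006, Thm 3.7(iii) p.41] -/
theorem aChar_apply {e m : ℕ} (hem : e ≤ m + 1) (x : Leaf (p := p) m) :
    aChar e m hem x = ofAdd (PadicInt.toZModPow e (x : Iw p).a) := rfl

/-- The translation character kills the torus image `lowHom m (ℤ_p)` (translation coordinate `0`).
[cite: MochizukiSemiAnbd2006, Thm 3.7(iii) p.41] -/
theorem aChar_lowHom {e m : ℕ} (hem : e ≤ m + 1) (t : Multiplicative ℤ_[p]) :
    aChar e m hem (lowHom m t) = 1 := by
  rw [aChar_apply, coe_lowHom, bHom_a, zero_mul, map_zero, ofAdd_zero]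

/-- The translation character of the unit translation is `1 (mod p^e)`. [cite: MochizukiSemiAnbd2006, Thm 3.7(iii) p.41] -/
theorem aChar_translLeaf {e m : ℕ} (hem : e ≤ m + 1) : aChar e m hem (translLeaf (p := p) m) = ofAdd 1 := by
  rw [aChar_apply]
  change ofAdd (PadicInt.toZModPow e (1 : ℤ_[p])) = ofAdd 1
  rw [map_one]

/-- The translation character kills the elements with translation coordinate of norm `≤ p^{-e}` (e.g. the leaf
levels). [cite: MochizukiSemiAnbd2006, Thm 3.7(iii) p.41] -/
theorem aChar_eq_one_of_norm_le {e m : ℕ} (hem : e ≤ m + 1) (x : Leaf (p := p) m)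
    (hx : ‖(x : Iw p).a‖ ≤ (p : ℝ) ^ (-(e : ℤ))) : aChar e m hem x = 1 := by
  rw [aChar_apply, PadicIntLevels.toZModPow_eq_zero_of_norm_le hx, ofAdd_zero]

/-- **The logarithmic character** `Leaf m → ℤ/p^e`, `(a, u) ↦ d · log_{u_m}(u) mod p^e`.
[cite: MochizukiSemiAnbd2006, Thm 3.7(iii) p.41] -/
def logChar (m e : ℕ) (d : ZMod (p ^ e)) : Leaf (p := p) m →ₜ* Multiplicative (ZMod (p ^ e)) where
  toFun x := ofAdd (d * PadicInt.toZModPow e (logHom m x).toAdd)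
  map_one' := by rw [MonoidHom.map_one, toAdd_one, RingHom.map_zero, mul_zero, ofAdd_zero]
  map_mul' x y := by rw [MonoidHom.map_mul, toAdd_mul, RingHom.map_add, mul_add, ofAdd_add]
  continuous_toFun :=
    continuous_ofAdd.comp (continuous_const.mul ((OneUnits.continuous_toZModPow p e).comp
      (continuous_toAdd.comp (continuous_logHom m))))

/-- Formula. [cite: MochizukiSemiAnbd2006, Thm 3.7(iii) p.41] -/
theorem logChar_apply (m e : ℕ) (d : ZMod (p ^ e)) (x : Leaf (p := p) m) :
    logChar m e d x = ofAdd (d * PadicInt.toZModPow e (logHom m x).toAdd) := rfl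

/-- The logarithmic character on the torus image: `lowHom m t ↦ d · t`. [cite: MochizukiSemiAnbd2006, Thm 3.7(iii) p.41] -/
theorem logChar_lowHom (m e : ℕ) (d : ZMod (p ^ e)) (t : Multiplicative ℤ_[p]) :
    logChar m e d (lowHom m t) = ofAdd (d * PadicInt.toZModPow e t.toAdd) := by
  rw [logChar_apply, logHom_lowHom]

end Iw

/-! ### The linear characters of the centre -/

namespace FreeProPRankTwo

variable (p)

/-- **The linear character** `F̂₂⁽ᵖ⁾ → ℤ/p^e`, `g ↦ c₁ u + c₂ v` for `ab(g) = (u, v)`.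
[cite: RibesZalesskii2010, §3.3] -/
def linChar (e : ℕ) (c₁ c₂ : ZMod (p ^ e)) : Grp p →ₜ* Multiplicative (ZMod (p ^ e)) where
  toFun g := ofAdd (c₁ * PadicInt.toZModPow e (ab p g).toAdd.1 + c₂ * PadicInt.toZModPow e (ab p g).toAdd.2)
  map_one' := by simp
  map_mul' x y := by
    simp only [map_mul, toAdd_mul, Prod.fst_add, Prod.snd_add, map_add, ← ofAdd_add]
    congr 1; ring
  continuous_toFun := by
    apply continuous_ofAdd.comp
    have hc : Continuous fun g : Grp p => (ab p g).toAdd := continuous_toAdd.comp (ab p).continuous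
    exact (continuous_const.mul ((OneUnits.continuous_toZModPow p e).comp (continuous_fst.comp hc))).add
      (continuous_const.mul ((OneUnits.continuous_toZModPow p e).comp (continuous_snd.comp hc)))

/-- Formula. [cite: RibesZalesskii2010, §3.3] -/
theorem linChar_apply (e : ℕ) (c₁ c₂ : ZMod (p ^ e)) (g : Grp p) :
    linChar p e c₁ c₂ g =
      ofAdd (c₁ * PadicInt.toZModPow e (ab p g).toAdd.1 + c₂ * PadicInt.toZModPow e (ab p g).toAdd.2) := rfl

/-- `linChar (a) = c₁`. [cite: RibesZalesskii2010, §3.3] -/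
theorem linChar_a (e : ℕ) (c₁ c₂ : ZMod (p ^ e)) : linChar p e c₁ c₂ (a p) = ofAdd c₁ := by
  rw [linChar_apply, ab_a, toAdd_ofAdd]; simp

/-- `linChar (θα m t) = (c₁ + c₂ p^m) t`. [cite: RibesZalesskii2010, §3.3] -/
theorem linChar_θα (e m : ℕ) (c₁ c₂ : ZMod (p ^ e)) (t : Multiplicative ℤ_[p]) :
    linChar p e c₁ c₂ (θα p m t) = ofAdd ((c₁ + c₂ * (p : ZMod (p ^ e)) ^ m) * PadicInt.toZModPow e t.toAdd) := by
  rw [linChar_apply]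
  change ofAdd (c₁ * PadicInt.toZModPow e (ab p (θ p m (α p t))).toAdd.1 +
    c₂ * PadicInt.toZModPow e (ab p (θ p m (α p t))).toAdd.2) = _
  rw [ab_θ_α, toAdd_ofAdd]
  simp only [map_mul, map_pow, map_natCast]
  congr 1; ring

end FreeProPRankTwo

/-! ### The two character families of `𝒢⋆(p)` -/

namespace ProfiniteSemiGraph

variable (p)

/-- **The translation family `ψ_{n,e}`** (`e ≤ n + 1`): `(a, u) ↦ a mod p^e` at the leaf `n`, trivial at the
centre and at the other leaves. [cite: MochizukiSemiAnbd2006, Thm 3.7(iii) p.41] -/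
def leafStarPsiV (n e : ℕ) (hen : e ≤ n + 1) :
    ∀ v : (metabelianLeafStar p).graph.Vertex, (metabelianLeafStar p).Gv v →ₜ* Multiplicative (ZMod (p ^ e))
  | none => 1
  | some m => if h : m = n then Iw.aChar e m (hen.trans (by rw [h])) else 1

/-- The translation family on the edges: trivial. [cite: MochizukiSemiAnbd2006, Thm 3.7(iii) p.41] -/
def leafStarPsiE (e : ℕ) :
    ∀ x : (metabelianLeafStar p).graph.Edge, (metabelianLeafStar p).Ge x →ₜ* Multiplicative (ZMod (p ^ e)) :=
  fun _ => 1

/-- The translation family at the centre is trivial. [cite: MochizukiSemiAnbd2006, Thm 3.7(iii) p.41] -/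
theorem leafStarPsiV_centre (n e : ℕ) (hen : e ≤ n + 1) (g : FreeProPRankTwo.Grp p) :
    leafStarPsiV p n e hen (leafStarCentre p) g = 1 := rfl

/-- The translation family at the leaf `n` is the translation character. [cite: MochizukiSemiAnbd2006, Thm 3.7(iii) p.41] -/
theorem leafStarPsiV_leaf_self (n e : ℕ) (hen : e ≤ n + 1) (x : Iw.Leaf (p := p) n) :
    leafStarPsiV p n e hen (leafStarLeaf p n) x = ofAdd (PadicInt.toZModPow e (x : Iw p).a) := by
  change (if h : n = n then Iw.aChar e n (hen.trans (by rw [h])) else 1) x = _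
  rw [dif_pos rfl]; rfl

/-- The translation family at a leaf `m ≠ n` is trivial. [cite: MochizukiSemiAnbd2006, Thm 3.7(iii) p.41] -/
theorem leafStarPsiV_leaf_ne (n e : ℕ) (hen : e ≤ n + 1) {m : ℕ} (hm : m ≠ n) (x : Iw.Leaf (p := p) m) :
    leafStarPsiV p n e hen (leafStarLeaf p m) x = 1 := by
  change (if h : m = n then Iw.aChar e m (hen.trans (by rw [h])) else 1) x = _
  rw [dif_neg hm]; rfl

/-- The translation family at ANY leaf `m` is given by the translation coordinate when `e ≤ m + 1` (value `1`
for `m ≠ n`); in particular it kills every element whose translation coordinate has norm `≤ p^{-e}`.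
[cite: MochizukiSemiAnbd2006, Thm 3.7(iii) p.41] -/
theorem leafStarPsiV_leaf_eq_one_of_norm_le (n e : ℕ) (hen : e ≤ n + 1) (m : ℕ) (x : Iw.Leaf (p := p) m)
    (hx : ‖(x : Iw p).a‖ ≤ (p : ℝ) ^ (-(e : ℤ))) : leafStarPsiV p n e hen (leafStarLeaf p m) x = 1 := by
  by_cases hm : m = n
  · subst hm
    rw [leafStarPsiV_leaf_self, PadicIntLevels.toZModPow_eq_zero_of_norm_le hx, ofAdd_zero]
  · exact leafStarPsiV_leaf_ne p n e hen hm x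

/-- The translation family of the unit translation of the leaf `n` is `1 (mod p^e)`.
[cite: MochizukiSemiAnbd2006, Thm 3.7(iii) p.41] -/
theorem leafStarPsiV_translLeaf (n e : ℕ) (hen : e ≤ n + 1) :
    leafStarPsiV p n e hen (leafStarLeaf p n) (Iw.translLeaf n) = ofAdd 1 := by
  rw [leafStarPsiV_leaf_self]
  change ofAdd (PadicInt.toZModPow e (1 : ℤ_[p])) = ofAdd 1
  rw [map_one]

/-- The translation family kills the torus images `lowHom m (ℤ_p)` at every leaf.
[cite: MochizukiSemiAnbd2006, Thm 3.7(iii) p.41] -/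
theorem leafStarPsiV_lowHom (n e : ℕ) (hen : e ≤ n + 1) (m : ℕ) (t : Multiplicative ℤ_[p]) :
    leafStarPsiV p n e hen (leafStarLeaf p m) (Iw.lowHom m t) = 1 := by
  apply leafStarPsiV_leaf_eq_one_of_norm_le
  rw [Iw.coe_lowHom, Iw.bHom_a, zero_mul, norm_zero]
  positivity

/-- **Compatibility of the translation family with the gluings** (both sides trivial on branch images).
[cite: MochizukiSemiAnbd2006, Thm 3.7(iii) p.41] -/
theorem leafStarPsi_compatible (n e : ℕ) (hen : e ≤ n + 1) (b : (metabelianLeafStar p).graph.Branch)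
    (v : (metabelianLeafStar p).graph.Vertex) (h : (metabelianLeafStar p).graph.abuts b = some v)
    (t : (metabelianLeafStar p).Ge ((metabelianLeafStar p).graph.edgeOf b)) :
    leafStarPsiV p n e hen v ((metabelianLeafStar p).brHom b v h t) =
      leafStarPsiE p e ((metabelianLeafStar p).graph.edgeOf b) t := by
  obtain ⟨m, c⟩ := b
  have hv : SemiGraph.leafStarVertexOf (m, c) = v := Option.some.inj h
  subst hv
  cases c
  · exact leafStarPsiV_lowHom p n e hen m t
  · rfl

/-- **The twisted abelian family `Φ^{(n)}`** (modulus `p^{n+1}`): `v − p^n u` at the centre, `(p^m − p^n)·log_{u_m}`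
at the leaf `m`. [cite: MochizukiSemiAnbd2006, Thm 3.7(iii) p.41] -/
def leafStarPhiV (n : ℕ) :
    ∀ v : (metabelianLeafStar p).graph.Vertex,
      (metabelianLeafStar p).Gv v →ₜ* Multiplicative (ZMod (p ^ (n + 1)))
  | none => FreeProPRankTwo.linChar p (n + 1) (-((p : ZMod (p ^ (n + 1))) ^ n)) 1
  | some m => Iw.logChar m (n + 1) ((p : ZMod (p ^ (n + 1))) ^ m - (p : ZMod (p ^ (n + 1))) ^ n)

/-- The edge character `ℤ_p → ℤ/p^{n+1}`, `t ↦ (p^m − p^n) t`. [cite: MochizukiSemiAnbd2006, Thm 3.7(iii) p.41] -/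
def leafStarPhiEdge (n m : ℕ) : Multiplicative ℤ_[p] →ₜ* Multiplicative (ZMod (p ^ (n + 1))) where
  toFun t := ofAdd (((p : ZMod (p ^ (n + 1))) ^ m - (p : ZMod (p ^ (n + 1))) ^ n) *
    PadicInt.toZModPow (n + 1) (Multiplicative.toAdd t))
  map_one' := by rw [toAdd_one, RingHom.map_zero, mul_zero, ofAdd_zero]
  map_mul' x y := by rw [toAdd_mul, RingHom.map_add, mul_add, ofAdd_add]
  continuous_toFun := continuous_ofAdd.comp (continuous_const.mul
    ((OneUnits.continuous_toZModPow p (n + 1)).comp continuous_toAdd))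

/-- Formula. [cite: MochizukiSemiAnbd2006, Thm 3.7(iii) p.41] -/
theorem leafStarPhiEdge_apply (n m : ℕ) (t : Multiplicative ℤ_[p]) :
    leafStarPhiEdge p n m t = ofAdd (((p : ZMod (p ^ (n + 1))) ^ m - (p : ZMod (p ^ (n + 1))) ^ n) *
      PadicInt.toZModPow (n + 1) (Multiplicative.toAdd t)) := rfl

/-- The twisted abelian family on the edge `m`: `t ↦ (p^m − p^n) t`. [cite: MochizukiSemiAnbd2006, Thm 3.7(iii) p.41] -/
def leafStarPhiE (n : ℕ) :
    ∀ x : (metabelianLeafStar p).graph.Edge,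
      (metabelianLeafStar p).Ge x →ₜ* Multiplicative (ZMod (p ^ (n + 1))) :=
  fun m => leafStarPhiEdge p n m

/-- **`Φ^{(n)}(a) = −p^n`.** [cite: MochizukiSemiAnbd2006, Thm 3.7(iii) p.41] -/
theorem leafStarPhiV_centre_a (n : ℕ) :
    leafStarPhiV p n (leafStarCentre p) (FreeProPRankTwo.a p) = ofAdd (-((p : ZMod (p ^ (n + 1))) ^ n)) :=
  FreeProPRankTwo.linChar_a p (n + 1) _ _

/-- `−p^n ≠ 0` in `ℤ/p^{n+1}`: **`Φ^{(n)}(a) ≠ 1`.** [cite: MochizukiSemiAnbd2006, Thm 3.7(iii) p.41] -/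
theorem leafStarPhiV_centre_a_ne_one (n : ℕ) :
    leafStarPhiV p n (leafStarCentre p) (FreeProPRankTwo.a p) ≠ 1 := by
  rw [leafStarPhiV_centre_a, ← ofAdd_zero, Ne, ofAdd.apply_eq_iff_eq, neg_eq_zero, ← Nat.cast_pow,
    ZMod.natCast_eq_zero_iff]
  exact fun h => Nat.not_succ_le_self n ((Nat.pow_dvd_pow_iff_le_right hp.out.one_lt).1 h)

/-- **`Φ^{(n)}` kills the branch image of the edge `n` at the centre**: `Φ^{(n)}(θα n t) = (p^n − p^n) t = 0`.
[cite: MochizukiSemiAnbd2006, Thm 3.7(iii) p.41] -/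
theorem leafStarPhiV_centre_θα_self (n : ℕ) (t : Multiplicative ℤ_[p]) :
    leafStarPhiV p n (leafStarCentre p) (FreeProPRankTwo.θα p n t) = 1 := by
  change FreeProPRankTwo.linChar p (n + 1) _ _ (FreeProPRankTwo.θα p n t) = 1
  rw [FreeProPRankTwo.linChar_θα, one_mul, neg_add_cancel, zero_mul, ofAdd_zero]

/-- `Φ^{(n)}` at the centre on any branch image: `Φ^{(n)}(θα m t) = (p^m − p^n) t`. [cite: MochizukiSemiAnbd2006, Thm 3.7(iii) p.41] -/
theorem leafStarPhiV_centre_θα (n m : ℕ) (t : Multiplicative ℤ_[p]) :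
    leafStarPhiV p n (leafStarCentre p) (FreeProPRankTwo.θα p m t) = leafStarPhiEdge p n m t := by
  change FreeProPRankTwo.linChar p (n + 1) _ _ (FreeProPRankTwo.θα p m t) = _
  rw [FreeProPRankTwo.linChar_θα, one_mul, neg_add_eq_sub, leafStarPhiEdge_apply]

/-- `Φ^{(n)}` at the leaf `m` on the torus image: `Φ^{(n)}(lowHom m t) = (p^m − p^n) t`. [cite: MochizukiSemiAnbd2006, Thm 3.7(iii) p.41] -/
theorem leafStarPhiV_leaf_lowHom (n m : ℕ) (t : Multiplicative ℤ_[p]) :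
    leafStarPhiV p n (leafStarLeaf p m) (Iw.lowHom m t) = leafStarPhiEdge p n m t := by
  change Iw.logChar m (n + 1) _ (Iw.lowHom m t) = _
  rw [Iw.logChar_lowHom, leafStarPhiEdge_apply]

/-- **Compatibility of the twisted abelian family with the gluings.** [cite: MochizukiSemiAnbd2006, Thm 3.7(iii) p.41] -/
theorem leafStarPhi_compatible (n : ℕ) (b : (metabelianLeafStar p).graph.Branch)
    (v : (metabelianLeafStar p).graph.Vertex) (h : (metabelianLeafStar p).graph.abuts b = some v)
    (t : (metabelianLeafStar p).Ge ((metabelianLeafStar p).graph.edgeOf b)) :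
    leafStarPhiV p n v ((metabelianLeafStar p).brHom b v h t) =
      leafStarPhiE p n ((metabelianLeafStar p).graph.edgeOf b) t := by
  obtain ⟨m, c⟩ := b
  have hv : SemiGraph.leafStarVertexOf (m, c) = v := Option.some.inj h
  subst hv
  cases c
  · exact leafStarPhiV_leaf_lowHom p n m t
  · exact leafStarPhiV_centre_θα p n m t

end ProfiniteSemiGraph

end Literature.AnabelianGeometry.SemiGraphs

end
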